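import Summits.QuantumFields.BalabanUV.T4Continuum.Support.NE7FlatLiftBookkeeping
import HarnessLib

/-!
# NE7CurvedLiftBookkeeping — THE (APE) POINTWISE BOOTSTRAP WITH A DATUM: F44's skeleton `smallField_vary_of_flatLetters'` AT A CURVED BACKGROUND `W` OF THE
# MULTI-LEVEL SMALL-FIELD CLASS — the same seven letters, now relative to `W`, give `SmallField (W·e^{A}) (x + K_G(τ + ρ) + c_N + 28α₀²)`, `x` = the
# plaquette radius of `W`

Cell `pub-balaban`, rung (B)+1 sub-cell t4, lineage `b2b-balaban-t4-ne7-p1` (CRUX PROVER NE7 #1 = OWNER of row NE7), generation 75.  File F55 — the first file of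
the CURVED (APE) programme, over F44 `NE7FlatLiftBookkeeping` (gen 70) and row NE3's moving-plaquette Taylor bound `NE7SegmentPlaquetteRadius.norm_hol_taylor_le`.

WHY.  The trivial-datum programme F36–F54 ∕ ROAD v4 (gens 69–74) closed the a-priori estimate (APE) at the FLAT datum — and the NE7 desk (PRICING-NE7 v81, CLOSE
memo g83 item 5 «D-83-2 (APE)♭ ≡ RIGIDITY♭») and CRUX PROVER NE7 #2 (`NE7FlatFibreRigidity`, g89) located that at flat data the END is a UNIQUENESS statement: its
hypothesis class consists of pure gauges.  The substantive content of (APE) — the letter (APE)^path of F28∕F31 `NE7OneStepOfSectorApeRep` that the interior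
induction `NE7InteriorInduction` consumes at EVERY datum of the data path — lives at CURVED data, and «nothing with a datum is typed» (desk).  F44's skeleton
uses the flatness of its background `F̃` at exactly ONE place: the final pointwise Taylor step `‖F̃e^{A}(∂p′) − 1‖ ≤ c + 28α₀²`.  At a unitary background `W`
with plaquette radius `x` the same Taylor bound (row NE3's `norm_hol_taylor_le`, ANY unitary background) reads `‖We^{A}(∂p′) − 1‖ ≤ x + c + 28α₀²`.  Hence:

WHAT ([folklore]; 0 def, 0 sorry).
§1 **`norm_hol_vary_sub_one_le_of_curl_W`** — the curved pointwise step: unitary `W` with `‖W(∂p′) − 1‖ ≤ w₀`, skew `X` with `‖X(b)‖ ≤ α`, curl bound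
   `‖(d_W X)(p′)‖ ≤ c` ⟹ `‖(We^{X})(∂p′) − 1‖ ≤ w₀ + c + 28α²`.
§2 **`smallField_vary_of_curvedLetters`** — F44's `smallField_vary_of_flatLetters'` WITH A DATUM: the background is ANY unitary `W` of the multi-level class
   (`LevelSmall d L k x`, `SmallField W x` — row NE3's tower letters, needed by `NE3ResidualSliceRep.dirIter_sub`), NO flatness, NO criticality of `W`;
   F44's seven letters relative to `W` — the normal part `A_N` with `dirIter L (k+1) W A_N = dirIter L (k+1) W A` (hNexact), its curl `≤ c_N` (hN7), Hessian
   orthogonality `hess W A_N Y = 0` on `W`-tangent `Y` (hNorth), the slice solver on a set `S ∋ A − A_N` with constant `K_G` (hG), tangent-criticality of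
   `We^{A}` (hcrit), the tangent transport `τ` (hTT) — with ONE CORRECTION and ONE NEW LETTER forced by the datum: at a background that is not a free
   critical point the expansion of `dAction` has a FIRST-order term, so (hEXP) is the genuine second-order remainder
   `|dAction (We^{A}) Y − dAction W Y − hess W A Y| ≤ ρ·‖Y‖₁` (at `W` flat `dAction W ≡ 0` and this is F44's letter), and the background's own TENSION on
   the fibre enters as (hWten) `|dAction W Y| ≤ κ·‖Y‖₁` for `W`-tangent `Y` (`κ = 0` for a tangent-critical `W`, e.g. the fibre's minimiser; small for a
   regular near-minimiser).  Conclusion: `SmallField (vary W A 1) (x + (K_G(τ + ρ + κ) + c_N + 28α₀²))`.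
   At `W` flat (`x = κ = 0`) this is F44; at a curved TANGENT-CRITICAL background the hypotheses are inhabited by `A = 0` NON-TRIVIALLY (§3: `W` itself is
   not a pure gauge) — the vacuity test the desk asked for («REP(V) ∕ (APE)(V) with a datum, priced against NE7-RIGID-1 at V = flat»).
§3 `smallField_vary_of_curvedLetters_zero` — sanity IN KERNEL: at `A = A_N = 0` with `W` tangent-critical the eight letters hold with
   `c_N = ρ = τ = κ = 0`, `S = {0}`, any `K_G ≥ 0`, and the conclusion is `SmallField W (x + …·0)` (non-vacuity at curved data).

THE CURVED PROGRAMME THIS OPENS (successors; each letter one file, as F45–F54 did at the flat datum): REP(V;W) = the gauge `U^{u} = We^{A}` with `A` in B8's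
(1.38)-Landau gauge relative to `W` and the sup member — row NE3's brick E′ `Spine/NE3/CurvedLandauRep.exists_landauRep_W` (t4-ne3-p1 g27, landing by courier
pub-ymgap-dag-n16-b tonight); the normal lift at `W` (hNexact∕hNorth: row NE3's `QbarRightInverseB8` ∕ `NormalPartB8*`); the slice solver at `W` (hG: (P♮) at curved
`W` + `SupRegularityCurvedUniform`); the expansion remainder and the tangent transport at `W` (hEXP∕hTT: curved twins of F48b∕F53).
HONEST FRAMING (page 1): bookkeeping composition over DISPLAYED letters; nothing of Bałaban's asserted ([Balaban1985Variational] Sect. F TYPE, not its sentence);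
(APE) on curved data NOT proved (the letters are hypotheses); NOT ONE-STEP, NOT NE7; spine 0∕9; finite T⁴ rung (B)+1 — NOT infinite volume, NOT mass gap, NOT
`BetaPertH`, NOT Clay.  Continuum YM on T⁴ ⇐ BetaPertH ∧ nine spine estimates (0/9 proved); BetaPertH ⇐ (D1) ∧ (D4) ∧ CAP+tail; G-an2-4 gates asym, D1 and NE2/3/4.
-/

set_option autoImplicit false

open scoped BigOperators Matrix Matrix.Norms.L2Operator
open NormedSpace Finset Set

namespace Summit.QuantumFields.BalabanUV.T4Continuum.NE7CurvedLiftBookkeeping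

open Literature.MathematicalPhysics.QuantumFieldTheory.Balaban1983to89
open B7Prop1Explicit B7Prop2Explicit MatrixLog UnitaryModel
open T4AveragingDeficitWall (IsUnitaryCfg IsSkewDir SmallField vary curlAt dirL1 vary_zero)
open T4AveragingDeficitWallBoundary (IsPeriodicCfg periodBox)
open AveragingDeficitPeriodicCounting (IsPeriodicDir)
open AveragingDeficitMultiLevelPrep (LevelSmall)
open MinimalActionLevels (perWin)
open NE3HessForm (hess dAction)
open NE3HessBounds (bondSqAt)
open NE3TangentCovariantTower (dirIter)
open NE3ResidualSliceRep (dirIter_sub)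
open NE3EnergyHessBilin (hess_add_left curlAt_add)
open NE7SegmentPlaquetteRadius (norm_hol_taylor_le bondSqAt_le_of_sup)
open NE7ExactCurrent (dAction_add)

noncomputable section

variable {d : ℕ} {n : Type*} [Fintype n] [DecidableEq n]

/-! ## §1 The pointwise Taylor step at a curved plaquette -/

/-- **THE CURVED POINTWISE STEP**: for unitary `W` with `‖W(∂p′) − 1‖ ≤ w₀`, skew `X` with `‖X(b)‖ ≤ α` and a curl bound `‖(d_W X)(p′)‖ ≤ c`,
`‖(We^{X})(∂p′) − 1‖ ≤ w₀ + c + 28α²` (row NE3's `norm_hol_taylor_le` at an arbitrary unitary background; F44 §2a is the case `w₀ = 0`). [folklore] -/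
theorem norm_hol_vary_sub_one_le_of_curl_W [Nonempty n] {W : Site d → Fin d → (Matrix n n ℂ)ˣ} (hW : IsUnitaryCfg W)
    {X : Site d → Fin d → Matrix n n ℂ} (hX : IsSkewDir X) {α : ℝ} (hXα : ∀ y κ, ‖X y κ‖ ≤ α) (z : Site d) {μ ν : Fin d}
    {w₀ : ℝ} (hw₀ : ‖((hol W z (plaqWord μ ν) : (Matrix n n ℂ)ˣ) : Matrix n n ℂ) - 1‖ ≤ w₀)
    {c : ℝ} (hc : ‖curlAt W X z μ ν‖ ≤ c) :
    ‖((hol (vary W X 1) z (plaqWord μ ν) : (Matrix n n ℂ)ˣ) : Matrix n n ℂ) - 1‖ ≤ w₀ + c + 28 * α ^ 2 := by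
  set H0 : Matrix n n ℂ := ((hol W z (plaqWord μ ν) : (Matrix n n ℂ)ˣ) : Matrix n n ℂ) with hH0
  set H1 : Matrix n n ℂ := ((hol (vary W X 1) z (plaqWord μ ν) : (Matrix n n ℂ)ˣ) : Matrix n n ℂ) with hH1
  have hT := norm_hol_taylor_le hW hX z μ ν 0 1
  rw [vary_zero] at hT
  simp only [sub_zero, one_smul, one_pow, mul_one] at hT
  have hb := bondSqAt_le_of_sup hXα z μ ν
  have hH0u : ‖H0‖ = 1 :=
    CStarRing.norm_of_mem_unitary (mem_unitaryUnits.mp (hol_mem_of (S := unitaryUnits (Matrix n n ℂ)) (fun y κ => hW y κ) z (plaqWord μ ν)))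
  have hcH : ‖curlAt W X z μ ν * H0‖ ≤ c := by
    calc ‖curlAt W X z μ ν * H0‖ ≤ ‖curlAt W X z μ ν‖ * ‖H0‖ := norm_mul_le _ _
      _ ≤ c * 1 := by rw [hH0u]; exact mul_le_mul_of_nonneg_right hc zero_le_one
      _ = c := mul_one c
  have hsplit : H1 - 1 = (H1 - H0 - curlAt W X z μ ν * H0) + curlAt W X z μ ν * H0 + (H0 - 1) := by abel
  calc ‖H1 - 1‖ = ‖(H1 - H0 - curlAt W X z μ ν * H0) + curlAt W X z μ ν * H0 + (H0 - 1)‖ := by rw [hsplit]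
    _ ≤ ‖H1 - H0 - curlAt W X z μ ν * H0‖ + ‖curlAt W X z μ ν * H0‖ + ‖H0 - 1‖ := norm_add₃_le
    _ ≤ 7 * bondSqAt X z μ ν + c + w₀ := add_le_add (add_le_add hT hcH) hw₀
    _ ≤ w₀ + c + 28 * α ^ 2 := by linarith

/-! ## §2 The pointwise bootstrap with a datum -/

/-- **F44 WITH A DATUM — THE (APE) POINTWISE BOOTSTRAP AT A CURVED BACKGROUND OF THE MULTI-LEVEL CLASS** (statement in the module docstring): F44's
letters relative to a unitary `W` with `LevelSmall d L k x`, `SmallField W x` (no flatness, no criticality of `W`), with the genuine second-order remainder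
(hEXP) and the background tension (hWten), give `SmallField (vary W A 1) (x + (K_G(τ + ρ + κ) + c_N + 28α₀²))`.  Proof = F44's, with one more triangle
inequality and §1 as the last step. [folklore] -/
theorem smallField_vary_of_curvedLetters [Nonempty n] {L : ℕ} (hL : 1 ≤ L) (k : ℕ) {P : ℕ}
    {W : Site d → Fin d → (Matrix n n ℂ)ˣ} (hW : IsUnitaryCfg W)
    {x : ℝ} (hx : 0 ≤ x) (hs : LevelSmall d L k x) (hWx : SmallField W x)
    {A : Site d → Fin d → Matrix n n ℂ} (hA : IsSkewDir A) (hAP : IsPeriodicDir A (P : ℤ)) {α₀ : ℝ} (hAα : ∀ y μ, ‖A y μ‖ ≤ α₀)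
    {AN : Site d → Fin d → Matrix n n ℂ} (hNP : IsPeriodicDir AN (P : ℤ))
    (hNexact : dirIter L (k + 1) W AN = dirIter L (k + 1) W A)
    {cN : ℝ} (hN7 : ∀ z μ ν, μ ≠ ν → ‖curlAt W AN z μ ν‖ ≤ cN)
    (hNorth : ∀ Y : Site d → Fin d → Matrix n n ℂ, IsSkewDir Y → IsPeriodicDir Y (P : ℤ) → dirIter L (k + 1) W Y = 0 →
      hess W AN Y (perWin d P) = 0)
    (S : Set (Site d → Fin d → Matrix n n ℂ)) (hTS : (fun y μ => A y μ - AN y μ) ∈ S) {KG : ℝ}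
    (hG : ∀ X ∈ S, IsPeriodicDir X (P : ℤ) → dirIter L (k + 1) W X = 0 → ∀ g : ℝ, 0 ≤ g →
      (∀ Y : Site d → Fin d → Matrix n n ℂ, IsSkewDir Y → IsPeriodicDir Y (P : ℤ) → dirIter L (k + 1) W Y = 0 →
        |hess W X Y (perWin d P)| ≤ g * dirL1 Y (periodBox (d := d) P)) →
      ∀ z μ ν, μ ≠ ν → ‖curlAt W X z μ ν‖ ≤ KG * g)
    {ρ : ℝ} (hρ : 0 ≤ ρ)
    (hEXP : ∀ Y : Site d → Fin d → Matrix n n ℂ, IsSkewDir Y → IsPeriodicDir Y (P : ℤ) →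
      |dAction (vary W A 1) Y (perWin d P) - dAction W Y (perWin d P) - hess W A Y (perWin d P)| ≤ ρ * dirL1 Y (periodBox (d := d) P))
    {κ : ℝ} (hκ : 0 ≤ κ)
    (hWten : ∀ Y : Site d → Fin d → Matrix n n ℂ, IsSkewDir Y → IsPeriodicDir Y (P : ℤ) → dirIter L (k + 1) W Y = 0 →
      |dAction W Y (perWin d P)| ≤ κ * dirL1 Y (periodBox (d := d) P))
    (hcrit : ∀ Y' : Site d → Fin d → Matrix n n ℂ, IsSkewDir Y' → IsPeriodicDir Y' (P : ℤ) → dirIter L (k + 1) (vary W A 1) Y' = 0 →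
      dAction (vary W A 1) Y' (perWin d P) = 0)
    {τ : ℝ} (hτ : 0 ≤ τ)
    (hTT : ∀ Y : Site d → Fin d → Matrix n n ℂ, IsSkewDir Y → IsPeriodicDir Y (P : ℤ) → dirIter L (k + 1) W Y = 0 →
      ∃ Y' : Site d → Fin d → Matrix n n ℂ, IsSkewDir Y' ∧ IsPeriodicDir Y' (P : ℤ) ∧ dirIter L (k + 1) (vary W A 1) Y' = 0 ∧
        |dAction (vary W A 1) (fun y μ => Y' y μ - Y y μ) (perWin d P)| ≤ τ * dirL1 Y (periodBox (d := d) P)) :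
    SmallField (vary W A 1) (x + (KG * (τ + ρ + κ) + cN + 28 * α₀ ^ 2)) := by
  set X : Site d → Fin d → Matrix n n ℂ := fun y μ => A y μ - AN y μ with hXdef
  have hXP : IsPeriodicDir X (P : ℤ) := fun y i μ => by simp only [hXdef, hAP y i μ, hNP y i μ]
  have hXT : dirIter L (k + 1) W X = 0 := by
    rw [hXdef, dirIter_sub hL k hW hx hs hWx A AN, hNexact]
    funext z κ
    simp
  have hsrc : ∀ Y : Site d → Fin d → Matrix n n ℂ, IsSkewDir Y → IsPeriodicDir Y (P : ℤ) → dirIter L (k + 1) W Y = 0 →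
      |hess W X Y (perWin d P)| ≤ (τ + ρ + κ) * dirL1 Y (periodBox (d := d) P) := by
    intro Y hY hYP hYT
    have hsplitA : A = X + AN := by funext y μ; simp [hXdef]
    have hhess : hess W X Y (perWin d P) = hess W A Y (perWin d P) := by
      have h := hess_add_left W (perWin d P) X AN Y
      rw [← hsplitA, hNorth Y hY hYP hYT, add_zero] at h
      exact h.symm
    obtain ⟨Y', hY's, hY'P, hY'T, hY'd⟩ := hTT Y hY hYP hYT
    have hc := hcrit Y' hY's hY'P hY'T
    have hdec : dAction (vary W A 1) Y (perWin d P)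
        = dAction (vary W A 1) Y' (perWin d P) - dAction (vary W A 1) (fun y μ => Y' y μ - Y y μ) (perWin d P) := by
      have hYsum : Y' = Y + fun y μ => Y' y μ - Y y μ := by funext y μ; simp
      have h := dAction_add (vary W A 1) Y (fun y μ => Y' y μ - Y y μ) (perWin d P)
      rw [← hYsum] at h
      linarith
    have hdA : |dAction (vary W A 1) Y (perWin d P)| ≤ τ * dirL1 Y (periodBox (d := d) P) := by
      rw [hdec, hc, zero_sub, abs_neg]
      exact hY'd
    have hE := hEXP Y hY hYP
    have hK := hWten Y hY hYP hYT
    have htri : |hess W A Y (perWin d P)| ≤ |dAction (vary W A 1) Y (perWin d P)|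
        + |dAction (vary W A 1) Y (perWin d P) - dAction W Y (perWin d P) - hess W A Y (perWin d P)| + |dAction W Y (perWin d P)| := by
      have h := abs_sub_le (hess W A Y (perWin d P)) (dAction (vary W A 1) Y (perWin d P) - dAction W Y (perWin d P)) 0
      have h1 : |hess W A Y (perWin d P) - (dAction (vary W A 1) Y (perWin d P) - dAction W Y (perWin d P))|
          = |dAction (vary W A 1) Y (perWin d P) - dAction W Y (perWin d P) - hess W A Y (perWin d P)| := by
        rw [abs_sub_comm]
      have h2 : |dAction (vary W A 1) Y (perWin d P) - dAction W Y (perWin d P) - 0|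
          ≤ |dAction (vary W A 1) Y (perWin d P)| + |dAction W Y (perWin d P)| := by
        rw [sub_zero]; exact abs_sub _ _
      rw [sub_zero] at h
      linarith
    rw [hhess]
    calc |hess W A Y (perWin d P)|
        ≤ τ * dirL1 Y (periodBox (d := d) P) + ρ * dirL1 Y (periodBox (d := d) P) + κ * dirL1 Y (periodBox (d := d) P) := by linarith
      _ = (τ + ρ + κ) * dirL1 Y (periodBox (d := d) P) := by ring
  have hcurlX : ∀ z μ ν, μ ≠ ν → ‖curlAt W X z μ ν‖ ≤ KG * (τ + ρ + κ) :=
    hG X hTS hXP hXT (τ + ρ + κ) (add_nonneg (add_nonneg hτ hρ) hκ) hsrc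
  have hcurlA : ∀ z μ ν, μ ≠ ν → ‖curlAt W A z μ ν‖ ≤ KG * (τ + ρ + κ) + cN := by
    intro z μ ν hμν
    have hsplit : A = X + AN := by funext y κ; simp [hXdef]
    rw [hsplit, curlAt_add]
    exact (norm_add_le _ _).trans (add_le_add (hcurlX z μ ν hμν) (hN7 z μ ν hμν))
  intro z μ ν hμν
  have h := norm_hol_vary_sub_one_le_of_curl_W hW hA hAα z (hWx z μ ν hμν) (hcurlA z μ ν hμν)
  linarith

/-! ## §3 Sanity: the letters are inhabited NON-TRIVIALLY at a curved tangent-critical background -/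

/-- **NON-VACUITY AT CURVED DATA**: at `A = A_N = 0`, for a unitary `W` of the class that is TANGENT-CRITICAL (every skew periodic `W`-tangent direction
annihilates `dAction W`) the eight letters hold with `c_N = ρ = τ = κ = 0`, `S = {0}` and any `K_G ≥ 0`, and §2 returns the class radius of `W` (plus zero) — the
hypotheses are satisfiable by a background that is NOT a pure gauge (contrast: at flat data the END's class is the pure-gauge orbit, `NE7FlatFibreRigidity`).
Uses only `vary W 0 1 = W`, `hess W 0 Y = 0`, `curlAt W 0 = 0`, `dAction · 0 = 0`. [folklore] -/
theorem smallField_vary_of_curvedLetters_zero [Nonempty n] {L : ℕ} (hL : 1 ≤ L) (k : ℕ) {P : ℕ}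
    {W : Site d → Fin d → (Matrix n n ℂ)ˣ} (hW : IsUnitaryCfg W)
    {x : ℝ} (hx : 0 ≤ x) (hs : LevelSmall d L k x) (hWx : SmallField W x)
    (hcritW : ∀ Y : Site d → Fin d → Matrix n n ℂ, IsSkewDir Y → IsPeriodicDir Y (P : ℤ) → dirIter L (k + 1) W Y = 0 →
      dAction W Y (perWin d P) = 0)
    {KG : ℝ} (hKG : 0 ≤ KG) :
    SmallField (vary W (fun _ _ => (0 : Matrix n n ℂ)) 1) (x + (KG * (0 + 0 + 0) + 0 + 28 * (0 : ℝ) ^ 2)) := by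
  have hvary : vary W (fun (_ : Site d) (_ : Fin d) => (0 : Matrix n n ℂ)) 1 = W := by
    funext y μ
    apply Units.ext
    simp [vary]
  have h0skew : IsSkewDir (fun (_ : Site d) (_ : Fin d) => (0 : Matrix n n ℂ)) := fun _ _ => (skewAdjoint (Matrix n n ℂ)).zero_mem
  have h0per : IsPeriodicDir (fun (_ : Site d) (_ : Fin d) => (0 : Matrix n n ℂ)) (P : ℤ) := fun _ _ _ => rfl
  have hzz : ((fun (_ : Site d) (_ : Fin d) => (0 : Matrix n n ℂ)) + fun (_ : Site d) (_ : Fin d) => (0 : Matrix n n ℂ))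
      = fun (_ : Site d) (_ : Fin d) => (0 : Matrix n n ℂ) := by funext y μ; simp
  have hhess0 : ∀ Y : Site d → Fin d → Matrix n n ℂ, hess W (fun (_ : Site d) (_ : Fin d) => (0 : Matrix n n ℂ)) Y (perWin d P) = 0 := by
    intro Y
    have h := hess_add_left W (perWin d P) (fun (_ : Site d) (_ : Fin d) => (0 : Matrix n n ℂ)) (fun (_ : Site d) (_ : Fin d) => (0 : Matrix n n ℂ)) Y
    rw [hzz] at h
    linarith
  have hcurl0 : ∀ z μ ν, curlAt W (fun (_ : Site d) (_ : Fin d) => (0 : Matrix n n ℂ)) z μ ν = 0 := by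
    intro z μ ν
    have h := curlAt_add W (fun (_ : Site d) (_ : Fin d) => (0 : Matrix n n ℂ)) (fun (_ : Site d) (_ : Fin d) => (0 : Matrix n n ℂ)) z μ ν
    rw [hzz] at h
    have h' : curlAt W (fun (_ : Site d) (_ : Fin d) => (0 : Matrix n n ℂ)) z μ ν + curlAt W (fun (_ : Site d) (_ : Fin d) => (0 : Matrix n n ℂ)) z μ ν
        = curlAt W (fun (_ : Site d) (_ : Fin d) => (0 : Matrix n n ℂ)) z μ ν + 0 := by rw [add_zero]; exact h.symm
    exact add_left_cancel h'
  have hdA0 : ∀ V : Site d → Fin d → (Matrix n n ℂ)ˣ, dAction V (fun (_ : Site d) (_ : Fin d) => (0 : Matrix n n ℂ)) (perWin d P) = 0 := by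
    intro V
    have h := dAction_add V (fun (_ : Site d) (_ : Fin d) => (0 : Matrix n n ℂ)) (fun (_ : Site d) (_ : Fin d) => (0 : Matrix n n ℂ)) (perWin d P)
    rw [hzz] at h
    linarith
  refine smallField_vary_of_curvedLetters hL k hW hx hs hWx h0skew h0per (α₀ := 0) (fun y μ => by simp) h0per rfl
    (cN := 0) (fun z μ ν _ => by rw [hcurl0, norm_zero]) (fun Y _ _ _ => hhess0 Y)
    {fun (_ : Site d) (_ : Fin d) => (0 : Matrix n n ℂ)} (by simp) (KG := KG) ?_ le_rfl ?_ le_rfl ?_ ?_ le_rfl ?_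
  · -- hG on `S = {0}`: the curl of `0` vanishes
    intro X hX _ _ g hg _ z μ ν _
    rw [Set.mem_singleton_iff.mp hX, hcurl0, norm_zero]
    exact mul_nonneg hKG hg
  · -- hEXP: at `A = 0` the second-order remainder vanishes identically
    intro Y _ _
    rw [hvary, hhess0, sub_self, sub_zero, abs_zero, zero_mul]
  · -- hWten with `κ = 0`: tangent-criticality of `W`
    intro Y hY hYP hYT
    rw [hcritW Y hY hYP hYT, abs_zero, zero_mul]
  · -- hcrit: `We^{0} = W` is tangent-critical
    intro Y' hY' hY'P hY'T
    rw [hvary] at hY'T ⊢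
    exact hcritW Y' hY' hY'P hY'T
  · -- hTT with `τ = 0`: transport `Y ↦ Y`
    intro Y hY hYP hYT
    refine ⟨Y, hY, hYP, by rw [hvary]; exact hYT, ?_⟩
    have hzero : (fun y μ => Y y μ - Y y μ) = fun (_ : Site d) (_ : Fin d) => (0 : Matrix n n ℂ) := by funext y μ; simp
    rw [hzero, hdA0, abs_zero, zero_mul]

end

end Summit.QuantumFields.BalabanUV.T4Continuum.NE7CurvedLiftBookkeeping
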